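import Literature.Computability.Complexity.OccurrenceObstructionsIPMainPositivity
import HarnessLib

/-!
# Ikenmeyer–Panova 2017, Thm. 4.6 from the square positivity and Kronecker coefficients of
# `S_n`, `n ≤ 25`

Sibling proofs file (D-0014) of `Literature/Computability/Complexity/OccurrenceObstructionsIP.lean`
(the named fact `ikenmeyerPanova2017_thm_4_6`), sharpening
`OccurrenceObstructionsIPMainPositivity.lean`: there, IP Thm. 4.6 is proved from the square
positivity and the computer calculations of the printed proof, all in `S₄₉` (frame `7 × 7`); here
the same conclusion is drawn from the square positivity and **positivity statements in the smallest
frames where they hold** — 33 single Kronecker coefficients of `S_n` for `n ∈ {6, 9, 12, 15, 16, 18,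
20, 24}` and the five hook families of Cor. 4.5 against `5 × 5` (`S₂₅`) instead of `7 × 7` — which is
what a future evaluator of characters of small symmetric groups would have to certify. Theorems
only; no definition, no statement of the tree is changed and no named fact is introduced.

The reduction uses only tree theorems: growth of the frame (`kroneckerCoeff_pos_of_frame_le`: a
shape positive against `r × s` stays positive against `a × b`, `a ≥ r`, `b ≥ s`), the proved
Prop. 4.3 in its sharp form (`ikenmeyerPanova2017_prop_4_3_core`, whose bookkeeping inequalities
(I), (II) already hold at `a = 5` for the five `ρ ∈ 𝔛 ∖ {(3,1)}`: the printed `a > 6` is not needed),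
and `g(2 × 2, 2 × 2, 2 × 2) > 0` (the square positivity at `k = 2`) for the group `{1, 1}`.

The frames are minimal: by direct evaluation of characters (outside the tree) each listed shape has
Kronecker coefficient `0` against every strictly smaller admissible frame, and (see the module
docstring of `OccurrenceObstructionsIPMainPositivity.lean`) none of them is a row-wise sum of two
positive triples; e.g. `{6,6,6}` (body `(3⁶)`) first becomes positive against `4 × 6` (`S₂₄`), and
the interval pattern of Cor. 4.5 first holds at `5 × 5` (it fails at `4 × 4` for `ρ = (1), (1⁴),
(1⁶)`).

Source: C. Ikenmeyer, G. Panova, Adv. Math. 319 (2017) 40–66 = arXiv:1512.03798 (held), §4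
(Cor. 4.5, Thm. 4.6 and their computer-verified base cases). [key `IkenmeyerPanova2017`]
-/

noncomputable section

open scoped BigOperators

namespace Literature.Computability.Complexity

open Literature.NumberTheory.DiophantineGeometry (kroneckerCoeff)

/-- **Growing the frame of a computed shape**: if every shape with a new first row over the columns
`A` is positive against `r × s` (and such a shape exists there: `Σ A + |A| ≤ rs`), then every such
shape is positive against `a × b` for `a ≥ r`, `b ≥ s`. [folklore] -/
theorem pos_of_frame_of_forall {r s a b : ℕ} (hra : r ≤ a) (hsb : s ≤ b) {A : Multiset ℕ} {L : ℕ}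
    (hA : ∀ x ∈ A, 1 ≤ x ∧ x ≤ L) (hArs : A.sum + A.card ≤ r * s)
    (h : ∀ lam : Nat.Partition (r * s),
      (∀ i, lam.sortedParts.getD (i + 1) 0 = (A.filter (i + 1 ≤ ·)).card) →
      0 < kroneckerCoeff ℂ lam (Nat.Partition.rectangle r s) (Nat.Partition.rectangle r s))
    (lam : Nat.Partition (a * b))
    (hlam : ∀ i, lam.sortedParts.getD (i + 1) 0 = (A.filter (i + 1 ≤ ·)).card) :
    0 < kroneckerCoeff ℂ lam (Nat.Partition.rectangle a b) (Nat.Partition.rectangle a b) := by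
  obtain ⟨mu, hmu⟩ := exists_partition_of_cols A hA hArs
  exact kroneckerCoeff_pos_of_frame_le mu (h mu hmu) hra hsb lam fun i => by rw [hlam i, hmu i]

/-- **The group `{1, 1}` (body `(2)`) from the square positivity at `k = 2`**:
`g((2,2), (2,2), (2,2)) > 0` is the shape `(2,2)` — a new first row of `2` boxes over two columns of
length `1` — against `2 × 2`; grow the frame to `7 × 7`. [cite: IkenmeyerPanova2017, §1.1 (the square positivity), k = 2] -/
theorem pos_seven_pair_one_one (hsq : ikenmeyerPanova2017_square_pos) (lam : Nat.Partition (7 * 7))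
    (hlam : ∀ i, lam.sortedParts.getD (i + 1) 0 = (({1, 1} : Multiset ℕ).filter (i + 1 ≤ ·)).card) :
    0 < kroneckerCoeff ℂ lam (Nat.Partition.rectangle 7 7) (Nat.Partition.rectangle 7 7) := by
  refine kroneckerCoeff_pos_of_frame_le (Nat.Partition.rectangle 2 2) (hsq 2 (by norm_num))
    (by norm_num) (by norm_num) lam fun i => ?_
  rw [hlam i, colRows_pair, getD_sortedParts_rectangle]
  split_ifs <;> omega

/-! ### The five hook families from the frame `5 × 5` -/

section FamiliesFive

/-- **Cor. 4.5 (i), `ρ = (1)`, from the base `a = 5`**: granted `{1, j}` positive against `5 × 5` for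
`j ∈ [1, 22] ∖ {2, 21}`, it is positive against `c × c` for every `c ≥ 5` and
`j ∈ [1, c² - 3] ∖ {2, c² - 4}` (`ikenmeyerPanova2017_prop_4_3_core` at `a = 5`: (I) `16 < 26`,
(II) `17 < 25`). [cite: IkenmeyerPanova2017, Cor. 4.5 (i) with Prop. 4.3 (held: Cor. 22 (i), Prop. 20)] -/
theorem ikenmeyerPanova2017_cor_4_5_fam1_of_five
    (hbase : ∀ j, 1 ≤ j → j ≤ 22 → j ≠ 2 → j ≠ 21 → ∀ lam : Nat.Partition (5 * 5),
      (∀ r, lam.sortedParts.getD (r + 1) 0 = (({1, j} : Multiset ℕ).filter (r + 1 ≤ ·)).card) →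
      0 < kroneckerCoeff ℂ lam (Nat.Partition.rectangle 5 5) (Nat.Partition.rectangle 5 5))
    {c : ℕ} (hc : 5 ≤ c) {j : ℕ} (hj : 1 ≤ j) (hjR : j + 3 ≤ c * c) (hj2 : j ≠ 2)
    (hj4 : c * c - j ≠ 4) (lam : Nat.Partition (c * c))
    (hlam : ∀ r, lam.sortedParts.getD (r + 1) 0 =
      (({1, j} : Multiset ℕ).filter (r + 1 ≤ ·)).card) :
    0 < kroneckerCoeff ℂ lam (Nat.Partition.rectangle c c) (Nat.Partition.rectangle c c) := by
  have hcard := card_parts_indiscrete_one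
  have h0 : (Nat.Partition.indiscrete 1).sortedParts.getD 0 0 = 1 := by
    rw [getD_sortedParts_indiscrete, if_pos rfl]
  refine ikenmeyerPanova2017_prop_4_3_core (Nat.Partition.indiscrete 1) {2} {4} (M₁ := 2) (M₂ := 4)
    (a := 5) (b := c) (k := j) (by simp) (by simp) (by norm_num) (by rw [hcard, h0]; norm_num)
    (by intro _; rw [hcard]; norm_num) ?_ hc (by rw [hcard]; exact hj) (by rw [h0]; omega)
    (by simpa using hj2) (by simpa using hj4) lam (fun r => by rw [hlam r, getD_colAdd_indiscrete_one])
  intro k hk hkR hk1 hk2 mu hmu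
  rw [hcard] at hk
  rw [h0] at hkR
  exact hbase k hk (by omega) (by simpa using hk1) (fun h21 => hk2 (by simp [h21])) mu
    fun r => by rw [hmu r, getD_colAdd_indiscrete_one]

/-- **Cor. 4.5 (iii), `ρ = (1,1)`, from the base `a = 5`** (`j ∈ [2, 21] ∖ {20}` against `5 × 5`):
every `c ≥ 5` and `j ∈ [2, c² - 4] ∖ {c² - 5}` ((I) `16 < 26`, (II) `17 < 25`).
[cite: IkenmeyerPanova2017, Cor. 4.5 (iii) with Prop. 4.3 (held: Cor. 22 (iii), Prop. 20)] -/
theorem ikenmeyerPanova2017_cor_4_5_fam11_of_five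
    (hbase : ∀ j, 2 ≤ j → j ≤ 21 → j ≠ 20 → ∀ lam : Nat.Partition (5 * 5),
      (∀ r, lam.sortedParts.getD (r + 1) 0 = (({2, j} : Multiset ℕ).filter (r + 1 ≤ ·)).card) →
      0 < kroneckerCoeff ℂ lam (Nat.Partition.rectangle 5 5) (Nat.Partition.rectangle 5 5))
    {c : ℕ} (hc : 5 ≤ c) {j : ℕ} (hj : 2 ≤ j) (hjR : j + 4 ≤ c * c) (hj5 : c * c - j ≠ 5)
    (lam : Nat.Partition (c * c))
    (hlam : ∀ r, lam.sortedParts.getD (r + 1) 0 =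
      (({2, j} : Multiset ℕ).filter (r + 1 ≤ ·)).card) :
    0 < kroneckerCoeff ℂ lam (Nat.Partition.rectangle c c) (Nat.Partition.rectangle c c) := by
  have hcard := card_parts_indiscrete_transpose 2
  have h0 := getD_zero_indiscrete_transpose (j := 2) (by norm_num)
  refine ikenmeyerPanova2017_prop_4_3_core (Nat.Partition.indiscrete 2).transpose ∅ {5} (M₁ := 0)
    (M₂ := 5) (a := 5) (b := c) (k := j) (by simp) (by simp) (by norm_num)
    (by rw [hcard, h0]; norm_num) (by intro _; rw [hcard]; norm_num) ?_ hc (by rw [hcard]; exact hj)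
    (by rw [h0]; omega) (by simp) (by simpa using hj5) lam
    (fun r => by rw [hlam r, getD_colAdd_indiscrete_transpose])
  intro k hk hkR _ hk2 mu hmu
  rw [hcard] at hk
  rw [h0] at hkR
  exact hbase k hk (by omega) (fun h20 => hk2 (by simp [h20])) mu
    fun r => by rw [hmu r, getD_colAdd_indiscrete_transpose]

/-- **Cor. 4.5, `ρ = (1⁴)`, from the base `a = 5`** (`j ∈ [4, 19]` against `5 × 5`): every `c ≥ 5`
and `j ∈ [4, c² - 6]` ((I) `20 < 26`). [cite: IkenmeyerPanova2017, Cor. 4.5 with Prop. 4.3 (held: Cor. 22, Prop. 20)] -/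
theorem ikenmeyerPanova2017_cor_4_5_fam1111_of_five
    (hbase : ∀ j, 4 ≤ j → j ≤ 19 → ∀ lam : Nat.Partition (5 * 5),
      (∀ r, lam.sortedParts.getD (r + 1) 0 = (({4, j} : Multiset ℕ).filter (r + 1 ≤ ·)).card) →
      0 < kroneckerCoeff ℂ lam (Nat.Partition.rectangle 5 5) (Nat.Partition.rectangle 5 5))
    {c : ℕ} (hc : 5 ≤ c) {j : ℕ} (hj : 4 ≤ j) (hjR : j + 6 ≤ c * c) (lam : Nat.Partition (c * c))
    (hlam : ∀ r, lam.sortedParts.getD (r + 1) 0 =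
      (({4, j} : Multiset ℕ).filter (r + 1 ≤ ·)).card) :
    0 < kroneckerCoeff ℂ lam (Nat.Partition.rectangle c c) (Nat.Partition.rectangle c c) := by
  have hcard := card_parts_indiscrete_transpose 4
  have h0 := getD_zero_indiscrete_transpose (j := 4) (by norm_num)
  refine ikenmeyerPanova2017_prop_4_3_core (Nat.Partition.indiscrete 4).transpose ∅ ∅ (M₁ := 0)
    (M₂ := 0) (a := 5) (b := c) (k := j) (by simp) (by simp) (by norm_num)
    (by rw [hcard, h0]; norm_num) (fun h => absurd h (by simp)) ?_ hc (by rw [hcard]; exact hj)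
    (by rw [h0]; omega) (by simp) (by simp) lam
    (fun r => by rw [hlam r, getD_colAdd_indiscrete_transpose])
  intro k hk hkR _ _ mu hmu
  rw [hcard] at hk
  rw [h0] at hkR
  exact hbase k hk (by omega) mu fun r => by rw [hmu r, getD_colAdd_indiscrete_transpose]

/-- **Cor. 4.5, `ρ = (1⁶)`, from the base `a = 5`** (`j ∈ [6, 17]` against `5 × 5`): every `c ≥ 5`
and `j ∈ [6, c² - 8]` ((I) `24 < 26`). [cite: IkenmeyerPanova2017, Cor. 4.5 with Prop. 4.3 (held: Cor. 22, Prop. 20)] -/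
theorem ikenmeyerPanova2017_cor_4_5_fam111111_of_five
    (hbase : ∀ j, 6 ≤ j → j ≤ 17 → ∀ lam : Nat.Partition (5 * 5),
      (∀ r, lam.sortedParts.getD (r + 1) 0 = (({6, j} : Multiset ℕ).filter (r + 1 ≤ ·)).card) →
      0 < kroneckerCoeff ℂ lam (Nat.Partition.rectangle 5 5) (Nat.Partition.rectangle 5 5))
    {c : ℕ} (hc : 5 ≤ c) {j : ℕ} (hj : 6 ≤ j) (hjR : j + 8 ≤ c * c) (lam : Nat.Partition (c * c))
    (hlam : ∀ r, lam.sortedParts.getD (r + 1) 0 =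
      (({6, j} : Multiset ℕ).filter (r + 1 ≤ ·)).card) :
    0 < kroneckerCoeff ℂ lam (Nat.Partition.rectangle c c) (Nat.Partition.rectangle c c) := by
  have hcard := card_parts_indiscrete_transpose 6
  have h0 := getD_zero_indiscrete_transpose (j := 6) (by norm_num)
  refine ikenmeyerPanova2017_prop_4_3_core (Nat.Partition.indiscrete 6).transpose ∅ ∅ (M₁ := 0)
    (M₂ := 0) (a := 5) (b := c) (k := j) (by simp) (by simp) (by norm_num)
    (by rw [hcard, h0]; norm_num) (fun h => absurd h (by simp)) ?_ hc (by rw [hcard]; exact hj)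
    (by rw [h0]; omega) (by simp) (by simp) lam
    (fun r => by rw [hlam r, getD_colAdd_indiscrete_transpose])
  intro k hk hkR _ _ mu hmu
  rw [hcard] at hk
  rw [h0] at hkR
  exact hbase k hk (by omega) mu fun r => by rw [hmu r, getD_colAdd_indiscrete_transpose]

/-- **Cor. 4.5 (iv), `ρ = (2,1)`, from the base `a = 5`** (`j ∈ [2, 19]` against `5 × 5`): every
`c ≥ 5` and `j ∈ [2, c² - 6]` ((I) `18 < 26`). [cite: IkenmeyerPanova2017, Cor. 4.5 (iv) with Prop. 4.3 (held: Cor. 22 (iv), Prop. 20)] -/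
theorem ikenmeyerPanova2017_cor_4_5_fam21_of_five
    (hbase : ∀ j, 2 ≤ j → j ≤ 19 → ∀ lam : Nat.Partition (5 * 5),
      (∀ r, lam.sortedParts.getD (r + 1) 0 =
        (({1, 2, j} : Multiset ℕ).filter (r + 1 ≤ ·)).card) →
      0 < kroneckerCoeff ℂ lam (Nat.Partition.rectangle 5 5) (Nat.Partition.rectangle 5 5))
    {c : ℕ} (hc : 5 ≤ c) {j : ℕ} (hj : 2 ≤ j) (hjR : j + 6 ≤ c * c) (lam : Nat.Partition (c * c))
    (hlam : ∀ r, lam.sortedParts.getD (r + 1) 0 =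
      (({1, 2, j} : Multiset ℕ).filter (r + 1 ≤ ·)).card) :
    0 < kroneckerCoeff ℂ lam (Nat.Partition.rectangle c c) (Nat.Partition.rectangle c c) := by
  have hcard := card_parts_twoOne
  have h0 : ((Nat.Partition.indiscrete 2).transpose.rowAdd
      (Nat.Partition.indiscrete 1)).sortedParts.getD 0 0 = 2 := by rw [getD_twoOne]; rfl
  refine ikenmeyerPanova2017_prop_4_3_core
    ((Nat.Partition.indiscrete 2).transpose.rowAdd (Nat.Partition.indiscrete 1)) ∅ ∅ (M₁ := 0)
    (M₂ := 0) (a := 5) (b := c) (k := j) (by simp) (by simp) (by norm_num)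
    (by rw [hcard, h0]; norm_num) (fun h => absurd h (by simp)) ?_ hc (by rw [hcard]; exact hj)
    (by rw [h0]; omega) (by simp) (by simp) lam (fun r => by rw [hlam r, getD_colAdd_twoOne])
  intro k hk hkR _ _ mu hmu
  rw [hcard] at hk
  rw [h0] at hkR
  exact hbase k hk (by omega) mu fun r => by rw [hmu r, getD_colAdd_twoOne]

end FamiliesFive

/-! ### IP Thm. 4.6 from the square positivity and positivity in the smallest frames -/

/-- **IP Thm. 4.6 from the square positivity and Kronecker coefficients of `S_n`, `n ≤ 25`.** The
tree's named fact `ikenmeyerPanova2017_thm_4_6` follows from the square positivity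
(`ikenmeyerPanova2017_square_pos`) together with:
* `hsmall`: for each of the 33 groups of columns `A` listed with a frame `r × s` (`rs ≤ 24`), every
  shape with a new first row over the columns `A` is positive against `r × s` — the bodies
  `(2,2)`; `(3), (4,1), (3,1,1,1), (2,1,1,1), (2,1⁵), (3,3)`; `(3,1⁵), (3,2), (3,2,1,1), (3,3,1,1),
  (2,2,1,1), (2,2,1⁴), (2,2,2,1), (2,2,2,1,1,1), (2⁴)`; `(4,3), (3,2,1⁴), (3,2,2,2), (3,2,2,2,1,1),
  (3,3,1⁴), (3,3,2,2), (3,3,2,2,1,1), (3⁴), (2⁴,1,1), (2⁵,1), (2⁶)`; `(5,1)`; `(3,2⁵), (3,3,2⁴),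
  (3⁴,1,1)`; `(3⁴,2,2)`; `(3⁶)` against `2×3`; `3×3`; `3×4`; `3×5`; `4×4`; `3×6`; `4×5`; `4×6`;
* `hfam1, hfam11, hfam1111, hfam111111, hfam21`: the hook families of Cor. 4.5 against `5 × 5`:
  columns `{1, j}`, `j ∈ [1,22] ∖ {2,21}`; `{2, j}`, `j ∈ [2,21] ∖ {20}`; `{4, j}`, `j ∈ [4,19]`;
  `{6, j}`, `j ∈ [6,17]`; `{1, 2, j}`, `j ∈ [2,19]`.
The values, by evaluation of characters of `S_n` outside the tree (for whoever certifies them;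
`g(λ; r×s)` = `g(λ, r × s, r × s)`): `{2, 2}`: `g(2,2,2; 2×3) = 1`; `{1, 1, 1}`: `g(6,3; 3×3) = 1`; `{1, 1, 1, 2}`: `g(4,4,1; 3×3) =
1`; `{1, 1, 4}`: `g(3,3,1,1,1; 3×3) = 2`; `{1, 4}`: `g(4,2,1,1,1; 3×3) = 1`; `{1, 6}`:
`g(2,2,1,1,1,1,1; 3×3) = 1`; `{2, 2, 2}`: `g(3,3,3; 3×3) = 1`; `{1, 1, 6}`: `g(4,3,1,1,1,1,1; 3×4)
= 1`; `{1, 2, 2}`: `g(7,3,2; 3×4) = 1`; `{1, 2, 4}`: `g(5,3,2,1,1; 3×4) = 4`; `{2, 2, 4}`: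
`g(4,3,3,1,1; 3×4) = 2`; `{2, 4}`: `g(6,2,2,1,1; 3×4) = 1`; `{2, 6}`: `g(4,2,2,1,1,1,1; 3×4) = 2`;
`{3, 4}`: `g(5,2,2,2,1; 3×4) = 1`; `{3, 6}`: `g(3,2,2,2,1,1,1; 3×4) = 1`; `{4, 4}`: `g(4,2,2,2,2;
3×4) = 2`; `{1, 2, 2, 2}`: `g(8,4,3; 3×5) = 1`; `{1, 2, 6}`: `g(6,3,2,1,1,1,1; 3×5) = 3`; `{1, 4,
4}`: `g(6,3,2,2,2; 3×5) = 4`; `{1, 4, 6}`: `g(4,3,2,2,2,1,1; 3×5) = 3`; `{2, 2, 6}`: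
`g(5,3,3,1,1,1,1; 3×5) = 1`; `{2, 4, 4}`: `g(5,3,3,2,2; 3×5) = 2`; `{2, 4, 6}`: `g(3,3,3,2,2,1,1;
3×5) = 2`; `{4, 4, 4}`: `g(3,3,3,3,3; 3×5) = 1`; `{4, 6}`: `g(5,2,2,2,2,1,1; 3×5) = 1`; `{5, 6}`:
`g(4,2,2,2,2,2,1; 3×5) = 1`; `{6, 6}`: `g(3,2,2,2,2,2,2; 3×5) = 1`; `{1, 1, 1, 1, 2}`: `g(10,5,1;
4×4) = 1`; `{1, 6, 6}`: `g(5,3,2,2,2,2,2; 3×6) = 1`; `{2, 6, 6}`: `g(4,3,3,2,2,2,2; 3×6) = 1`;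
`{4, 4, 6}`: `g(4,3,3,3,3,1,1; 3×6) = 1`; `{4, 6, 6}`: `g(4,3,3,3,3,2,2; 4×5) = 12`; `{6, 6, 6}`:
`g(6,3,3,3,3,3,3; 4×6) = 26`.
These imply the hypotheses of `ikenmeyerPanova2017_thm_4_6_of_computations` (the printed `7 × 7`
computations): the groups by growth of the frame, the group `{1,1}` from `g(2×2, 2×2, 2×2) > 0`, and
the families by the proved Prop. 4.3 run from `a = 5`.
[cite: IkenmeyerPanova2017, Thm. 4.6 (held: Thm. 23), with Cor. 4.5 and Prop. 4.3] -/
theorem ikenmeyerPanova2017_thm_4_6_of_small_computations (hsq : ikenmeyerPanova2017_square_pos)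
    (hsmall : ∀ e ∈ ([
        (2, 3, {2, 2}),
        (3, 3, {1, 1, 1}),
        (3, 3, {1, 1, 1, 2}),
        (3, 3, {1, 1, 4}),
        (3, 3, {1, 4}),
        (3, 3, {1, 6}),
        (3, 3, {2, 2, 2}),
        (3, 4, {1, 1, 6}),
        (3, 4, {1, 2, 2}),
        (3, 4, {1, 2, 4}),
        (3, 4, {2, 2, 4}),
        (3, 4, {2, 4}),
        (3, 4, {2, 6}),
        (3, 4, {3, 4}),
        (3, 4, {3, 6}),
        (3, 4, {4, 4}),
        (3, 5, {1, 2, 2, 2}),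
        (3, 5, {1, 2, 6}),
        (3, 5, {1, 4, 4}),
        (3, 5, {1, 4, 6}),
        (3, 5, {2, 2, 6}),
        (3, 5, {2, 4, 4}),
        (3, 5, {2, 4, 6}),
        (3, 5, {4, 4, 4}),
        (3, 5, {4, 6}),
        (3, 5, {5, 6}),
        (3, 5, {6, 6}),
        (4, 4, {1, 1, 1, 1, 2}),
        (3, 6, {1, 6, 6}),
        (3, 6, {2, 6, 6}),
        (3, 6, {4, 4, 6}),
        (4, 5, {4, 6, 6}),
        (4, 6, {6, 6, 6})] : List (ℕ × ℕ × Multiset ℕ)),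
      ∀ lam : Nat.Partition (e.1 * e.2.1),
        (∀ i, lam.sortedParts.getD (i + 1) 0 = (e.2.2.filter (i + 1 ≤ ·)).card) →
        0 < kroneckerCoeff ℂ lam (Nat.Partition.rectangle e.1 e.2.1)
          (Nat.Partition.rectangle e.1 e.2.1))
    (hfam1 : ∀ j, 1 ≤ j → j ≤ 22 → j ≠ 2 → j ≠ 21 → ∀ lam : Nat.Partition (5 * 5),
      (∀ r, lam.sortedParts.getD (r + 1) 0 = (({1, j} : Multiset ℕ).filter (r + 1 ≤ ·)).card) →
      0 < kroneckerCoeff ℂ lam (Nat.Partition.rectangle 5 5) (Nat.Partition.rectangle 5 5))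
    (hfam11 : ∀ j, 2 ≤ j → j ≤ 21 → j ≠ 20 → ∀ lam : Nat.Partition (5 * 5),
      (∀ r, lam.sortedParts.getD (r + 1) 0 = (({2, j} : Multiset ℕ).filter (r + 1 ≤ ·)).card) →
      0 < kroneckerCoeff ℂ lam (Nat.Partition.rectangle 5 5) (Nat.Partition.rectangle 5 5))
    (hfam1111 : ∀ j, 4 ≤ j → j ≤ 19 → ∀ lam : Nat.Partition (5 * 5),
      (∀ r, lam.sortedParts.getD (r + 1) 0 = (({4, j} : Multiset ℕ).filter (r + 1 ≤ ·)).card) →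
      0 < kroneckerCoeff ℂ lam (Nat.Partition.rectangle 5 5) (Nat.Partition.rectangle 5 5))
    (hfam111111 : ∀ j, 6 ≤ j → j ≤ 17 → ∀ lam : Nat.Partition (5 * 5),
      (∀ r, lam.sortedParts.getD (r + 1) 0 = (({6, j} : Multiset ℕ).filter (r + 1 ≤ ·)).card) →
      0 < kroneckerCoeff ℂ lam (Nat.Partition.rectangle 5 5) (Nat.Partition.rectangle 5 5))
    (hfam21 : ∀ j, 2 ≤ j → j ≤ 19 → ∀ lam : Nat.Partition (5 * 5),
      (∀ r, lam.sortedParts.getD (r + 1) 0 =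
        (({1, 2, j} : Multiset ℕ).filter (r + 1 ≤ ·)).card) →
      0 < kroneckerCoeff ℂ lam (Nat.Partition.rectangle 5 5) (Nat.Partition.rectangle 5 5)) :
    ikenmeyerPanova2017_thm_4_6 := by
  refine ikenmeyerPanova2017_thm_4_6_of_computations hsq ?_ ?_ ?_ ?_ ?_ ?_ ?_
  · -- pairs and triples of bad columns
    intro A hA hAc hA12 hA112
    rcases hAc with h2 | h3
    · obtain ⟨x, y, rfl⟩ := Multiset.card_eq_two.1 h2
      have hx := hA x (by simp)
      have hy := hA y (by simp)
      rcases hx with rfl | rfl | rfl | rfl <;> rcases hy with rfl | rfl | rfl | rfl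
      · exact pos_seven_pair_one_one hsq
      · exact absurd (by decide : ({1, 2} : Multiset ℕ) = {1, 2}) hA12
      · exact pos_of_frame_of_forall (by norm_num) (by norm_num) (L := 6) (by decide) (by decide)
          (hsmall (3, 3, {1, 4}) (by decide))
      · exact pos_of_frame_of_forall (by norm_num) (by norm_num) (L := 6) (by decide) (by decide)
          (hsmall (3, 3, {1, 6}) (by decide))
      · exact absurd (by decide : ({2, 1} : Multiset ℕ) = {1, 2}) hA12
      · exact pos_of_frame_of_forall (by norm_num) (by norm_num) (L := 6) (by decide) (by decide)
          (hsmall (2, 3, {2, 2}) (by decide))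
      · exact pos_of_frame_of_forall (by norm_num) (by norm_num) (L := 6) (by decide) (by decide)
          (hsmall (3, 4, {2, 4}) (by decide))
      · exact pos_of_frame_of_forall (by norm_num) (by norm_num) (L := 6) (by decide) (by decide)
          (hsmall (3, 4, {2, 6}) (by decide))
      · rw [show ({4, 1} : Multiset ℕ) = {1, 4} from by decide]
        exact pos_of_frame_of_forall (by norm_num) (by norm_num) (L := 6) (by decide) (by decide)
          (hsmall (3, 3, {1, 4}) (by decide))
      · rw [show ({4, 2} : Multiset ℕ) = {2, 4} from by decide]
        exact pos_of_frame_of_forall (by norm_num) (by norm_num) (L := 6) (by decide) (by decide)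
          (hsmall (3, 4, {2, 4}) (by decide))
      · exact pos_of_frame_of_forall (by norm_num) (by norm_num) (L := 6) (by decide) (by decide)
          (hsmall (3, 4, {4, 4}) (by decide))
      · exact pos_of_frame_of_forall (by norm_num) (by norm_num) (L := 6) (by decide) (by decide)
          (hsmall (3, 5, {4, 6}) (by decide))
      · rw [show ({6, 1} : Multiset ℕ) = {1, 6} from by decide]
        exact pos_of_frame_of_forall (by norm_num) (by norm_num) (L := 6) (by decide) (by decide)
          (hsmall (3, 3, {1, 6}) (by decide))
      · rw [show ({6, 2} : Multiset ℕ) = {2, 6} from by decide]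
        exact pos_of_frame_of_forall (by norm_num) (by norm_num) (L := 6) (by decide) (by decide)
          (hsmall (3, 4, {2, 6}) (by decide))
      · rw [show ({6, 4} : Multiset ℕ) = {4, 6} from by decide]
        exact pos_of_frame_of_forall (by norm_num) (by norm_num) (L := 6) (by decide) (by decide)
          (hsmall (3, 5, {4, 6}) (by decide))
      · exact pos_of_frame_of_forall (by norm_num) (by norm_num) (L := 6) (by decide) (by decide)
          (hsmall (3, 5, {6, 6}) (by decide))
    · obtain ⟨x, y, z, rfl⟩ := Multiset.card_eq_three.1 h3
      have hx := hA x (by simp)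
      have hy := hA y (by simp)
      have hz := hA z (by simp)
      rcases hx with rfl | rfl | rfl | rfl <;> rcases hy with rfl | rfl | rfl | rfl <;>
        rcases hz with rfl | rfl | rfl | rfl
      · exact pos_of_frame_of_forall (by norm_num) (by norm_num) (L := 6) (by decide) (by decide)
          (hsmall (3, 3, {1, 1, 1}) (by decide))
      · exact absurd (by decide : ({1, 1, 2} : Multiset ℕ) = {1, 1, 2}) hA112
      · exact pos_of_frame_of_forall (by norm_num) (by norm_num) (L := 6) (by decide) (by decide)
          (hsmall (3, 3, {1, 1, 4}) (by decide))
      · exact pos_of_frame_of_forall (by norm_num) (by norm_num) (L := 6) (by decide) (by decide)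
          (hsmall (3, 4, {1, 1, 6}) (by decide))
      · exact absurd (by decide : ({1, 2, 1} : Multiset ℕ) = {1, 1, 2}) hA112
      · exact pos_of_frame_of_forall (by norm_num) (by norm_num) (L := 6) (by decide) (by decide)
          (hsmall (3, 4, {1, 2, 2}) (by decide))
      · exact pos_of_frame_of_forall (by norm_num) (by norm_num) (L := 6) (by decide) (by decide)
          (hsmall (3, 4, {1, 2, 4}) (by decide))
      · exact pos_of_frame_of_forall (by norm_num) (by norm_num) (L := 6) (by decide) (by decide)
          (hsmall (3, 5, {1, 2, 6}) (by decide))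
      · rw [show ({1, 4, 1} : Multiset ℕ) = {1, 1, 4} from by decide]
        exact pos_of_frame_of_forall (by norm_num) (by norm_num) (L := 6) (by decide) (by decide)
          (hsmall (3, 3, {1, 1, 4}) (by decide))
      · rw [show ({1, 4, 2} : Multiset ℕ) = {1, 2, 4} from by decide]
        exact pos_of_frame_of_forall (by norm_num) (by norm_num) (L := 6) (by decide) (by decide)
          (hsmall (3, 4, {1, 2, 4}) (by decide))
      · exact pos_of_frame_of_forall (by norm_num) (by norm_num) (L := 6) (by decide) (by decide)
          (hsmall (3, 5, {1, 4, 4}) (by decide))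
      · exact pos_of_frame_of_forall (by norm_num) (by norm_num) (L := 6) (by decide) (by decide)
          (hsmall (3, 5, {1, 4, 6}) (by decide))
      · rw [show ({1, 6, 1} : Multiset ℕ) = {1, 1, 6} from by decide]
        exact pos_of_frame_of_forall (by norm_num) (by norm_num) (L := 6) (by decide) (by decide)
          (hsmall (3, 4, {1, 1, 6}) (by decide))
      · rw [show ({1, 6, 2} : Multiset ℕ) = {1, 2, 6} from by decide]
        exact pos_of_frame_of_forall (by norm_num) (by norm_num) (L := 6) (by decide) (by decide)
          (hsmall (3, 5, {1, 2, 6}) (by decide))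
      · rw [show ({1, 6, 4} : Multiset ℕ) = {1, 4, 6} from by decide]
        exact pos_of_frame_of_forall (by norm_num) (by norm_num) (L := 6) (by decide) (by decide)
          (hsmall (3, 5, {1, 4, 6}) (by decide))
      · exact pos_of_frame_of_forall (by norm_num) (by norm_num) (L := 6) (by decide) (by decide)
          (hsmall (3, 6, {1, 6, 6}) (by decide))
      · exact absurd (by decide : ({2, 1, 1} : Multiset ℕ) = {1, 1, 2}) hA112
      · rw [show ({2, 1, 2} : Multiset ℕ) = {1, 2, 2} from by decide]
        exact pos_of_frame_of_forall (by norm_num) (by norm_num) (L := 6) (by decide) (by decide)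
          (hsmall (3, 4, {1, 2, 2}) (by decide))
      · rw [show ({2, 1, 4} : Multiset ℕ) = {1, 2, 4} from by decide]
        exact pos_of_frame_of_forall (by norm_num) (by norm_num) (L := 6) (by decide) (by decide)
          (hsmall (3, 4, {1, 2, 4}) (by decide))
      · rw [show ({2, 1, 6} : Multiset ℕ) = {1, 2, 6} from by decide]
        exact pos_of_frame_of_forall (by norm_num) (by norm_num) (L := 6) (by decide) (by decide)
          (hsmall (3, 5, {1, 2, 6}) (by decide))
      · rw [show ({2, 2, 1} : Multiset ℕ) = {1, 2, 2} from by decide]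
        exact pos_of_frame_of_forall (by norm_num) (by norm_num) (L := 6) (by decide) (by decide)
          (hsmall (3, 4, {1, 2, 2}) (by decide))
      · exact pos_of_frame_of_forall (by norm_num) (by norm_num) (L := 6) (by decide) (by decide)
          (hsmall (3, 3, {2, 2, 2}) (by decide))
      · exact pos_of_frame_of_forall (by norm_num) (by norm_num) (L := 6) (by decide) (by decide)
          (hsmall (3, 4, {2, 2, 4}) (by decide))
      · exact pos_of_frame_of_forall (by norm_num) (by norm_num) (L := 6) (by decide) (by decide)
          (hsmall (3, 5, {2, 2, 6}) (by decide))
      · rw [show ({2, 4, 1} : Multiset ℕ) = {1, 2, 4} from by decide]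
        exact pos_of_frame_of_forall (by norm_num) (by norm_num) (L := 6) (by decide) (by decide)
          (hsmall (3, 4, {1, 2, 4}) (by decide))
      · rw [show ({2, 4, 2} : Multiset ℕ) = {2, 2, 4} from by decide]
        exact pos_of_frame_of_forall (by norm_num) (by norm_num) (L := 6) (by decide) (by decide)
          (hsmall (3, 4, {2, 2, 4}) (by decide))
      · exact pos_of_frame_of_forall (by norm_num) (by norm_num) (L := 6) (by decide) (by decide)
          (hsmall (3, 5, {2, 4, 4}) (by decide))
      · exact pos_of_frame_of_forall (by norm_num) (by norm_num) (L := 6) (by decide) (by decide)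
          (hsmall (3, 5, {2, 4, 6}) (by decide))
      · rw [show ({2, 6, 1} : Multiset ℕ) = {1, 2, 6} from by decide]
        exact pos_of_frame_of_forall (by norm_num) (by norm_num) (L := 6) (by decide) (by decide)
          (hsmall (3, 5, {1, 2, 6}) (by decide))
      · rw [show ({2, 6, 2} : Multiset ℕ) = {2, 2, 6} from by decide]
        exact pos_of_frame_of_forall (by norm_num) (by norm_num) (L := 6) (by decide) (by decide)
          (hsmall (3, 5, {2, 2, 6}) (by decide))
      · rw [show ({2, 6, 4} : Multiset ℕ) = {2, 4, 6} from by decide]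
        exact pos_of_frame_of_forall (by norm_num) (by norm_num) (L := 6) (by decide) (by decide)
          (hsmall (3, 5, {2, 4, 6}) (by decide))
      · exact pos_of_frame_of_forall (by norm_num) (by norm_num) (L := 6) (by decide) (by decide)
          (hsmall (3, 6, {2, 6, 6}) (by decide))
      · rw [show ({4, 1, 1} : Multiset ℕ) = {1, 1, 4} from by decide]
        exact pos_of_frame_of_forall (by norm_num) (by norm_num) (L := 6) (by decide) (by decide)
          (hsmall (3, 3, {1, 1, 4}) (by decide))
      · rw [show ({4, 1, 2} : Multiset ℕ) = {1, 2, 4} from by decide]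
        exact pos_of_frame_of_forall (by norm_num) (by norm_num) (L := 6) (by decide) (by decide)
          (hsmall (3, 4, {1, 2, 4}) (by decide))
      · rw [show ({4, 1, 4} : Multiset ℕ) = {1, 4, 4} from by decide]
        exact pos_of_frame_of_forall (by norm_num) (by norm_num) (L := 6) (by decide) (by decide)
          (hsmall (3, 5, {1, 4, 4}) (by decide))
      · rw [show ({4, 1, 6} : Multiset ℕ) = {1, 4, 6} from by decide]
        exact pos_of_frame_of_forall (by norm_num) (by norm_num) (L := 6) (by decide) (by decide)
          (hsmall (3, 5, {1, 4, 6}) (by decide))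
      · rw [show ({4, 2, 1} : Multiset ℕ) = {1, 2, 4} from by decide]
        exact pos_of_frame_of_forall (by norm_num) (by norm_num) (L := 6) (by decide) (by decide)
          (hsmall (3, 4, {1, 2, 4}) (by decide))
      · rw [show ({4, 2, 2} : Multiset ℕ) = {2, 2, 4} from by decide]
        exact pos_of_frame_of_forall (by norm_num) (by norm_num) (L := 6) (by decide) (by decide)
          (hsmall (3, 4, {2, 2, 4}) (by decide))
      · rw [show ({4, 2, 4} : Multiset ℕ) = {2, 4, 4} from by decide]
        exact pos_of_frame_of_forall (by norm_num) (by norm_num) (L := 6) (by decide) (by decide)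
          (hsmall (3, 5, {2, 4, 4}) (by decide))
      · rw [show ({4, 2, 6} : Multiset ℕ) = {2, 4, 6} from by decide]
        exact pos_of_frame_of_forall (by norm_num) (by norm_num) (L := 6) (by decide) (by decide)
          (hsmall (3, 5, {2, 4, 6}) (by decide))
      · rw [show ({4, 4, 1} : Multiset ℕ) = {1, 4, 4} from by decide]
        exact pos_of_frame_of_forall (by norm_num) (by norm_num) (L := 6) (by decide) (by decide)
          (hsmall (3, 5, {1, 4, 4}) (by decide))
      · rw [show ({4, 4, 2} : Multiset ℕ) = {2, 4, 4} from by decide]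
        exact pos_of_frame_of_forall (by norm_num) (by norm_num) (L := 6) (by decide) (by decide)
          (hsmall (3, 5, {2, 4, 4}) (by decide))
      · exact pos_of_frame_of_forall (by norm_num) (by norm_num) (L := 6) (by decide) (by decide)
          (hsmall (3, 5, {4, 4, 4}) (by decide))
      · exact pos_of_frame_of_forall (by norm_num) (by norm_num) (L := 6) (by decide) (by decide)
          (hsmall (3, 6, {4, 4, 6}) (by decide))
      · rw [show ({4, 6, 1} : Multiset ℕ) = {1, 4, 6} from by decide]
        exact pos_of_frame_of_forall (by norm_num) (by norm_num) (L := 6) (by decide) (by decide)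
          (hsmall (3, 5, {1, 4, 6}) (by decide))
      · rw [show ({4, 6, 2} : Multiset ℕ) = {2, 4, 6} from by decide]
        exact pos_of_frame_of_forall (by norm_num) (by norm_num) (L := 6) (by decide) (by decide)
          (hsmall (3, 5, {2, 4, 6}) (by decide))
      · rw [show ({4, 6, 4} : Multiset ℕ) = {4, 4, 6} from by decide]
        exact pos_of_frame_of_forall (by norm_num) (by norm_num) (L := 6) (by decide) (by decide)
          (hsmall (3, 6, {4, 4, 6}) (by decide))
      · exact pos_of_frame_of_forall (by norm_num) (by norm_num) (L := 6) (by decide) (by decide)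
          (hsmall (4, 5, {4, 6, 6}) (by decide))
      · rw [show ({6, 1, 1} : Multiset ℕ) = {1, 1, 6} from by decide]
        exact pos_of_frame_of_forall (by norm_num) (by norm_num) (L := 6) (by decide) (by decide)
          (hsmall (3, 4, {1, 1, 6}) (by decide))
      · rw [show ({6, 1, 2} : Multiset ℕ) = {1, 2, 6} from by decide]
        exact pos_of_frame_of_forall (by norm_num) (by norm_num) (L := 6) (by decide) (by decide)
          (hsmall (3, 5, {1, 2, 6}) (by decide))
      · rw [show ({6, 1, 4} : Multiset ℕ) = {1, 4, 6} from by decide]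
        exact pos_of_frame_of_forall (by norm_num) (by norm_num) (L := 6) (by decide) (by decide)
          (hsmall (3, 5, {1, 4, 6}) (by decide))
      · rw [show ({6, 1, 6} : Multiset ℕ) = {1, 6, 6} from by decide]
        exact pos_of_frame_of_forall (by norm_num) (by norm_num) (L := 6) (by decide) (by decide)
          (hsmall (3, 6, {1, 6, 6}) (by decide))
      · rw [show ({6, 2, 1} : Multiset ℕ) = {1, 2, 6} from by decide]
        exact pos_of_frame_of_forall (by norm_num) (by norm_num) (L := 6) (by decide) (by decide)
          (hsmall (3, 5, {1, 2, 6}) (by decide))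
      · rw [show ({6, 2, 2} : Multiset ℕ) = {2, 2, 6} from by decide]
        exact pos_of_frame_of_forall (by norm_num) (by norm_num) (L := 6) (by decide) (by decide)
          (hsmall (3, 5, {2, 2, 6}) (by decide))
      · rw [show ({6, 2, 4} : Multiset ℕ) = {2, 4, 6} from by decide]
        exact pos_of_frame_of_forall (by norm_num) (by norm_num) (L := 6) (by decide) (by decide)
          (hsmall (3, 5, {2, 4, 6}) (by decide))
      · rw [show ({6, 2, 6} : Multiset ℕ) = {2, 6, 6} from by decide]
        exact pos_of_frame_of_forall (by norm_num) (by norm_num) (L := 6) (by decide) (by decide)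
          (hsmall (3, 6, {2, 6, 6}) (by decide))
      · rw [show ({6, 4, 1} : Multiset ℕ) = {1, 4, 6} from by decide]
        exact pos_of_frame_of_forall (by norm_num) (by norm_num) (L := 6) (by decide) (by decide)
          (hsmall (3, 5, {1, 4, 6}) (by decide))
      · rw [show ({6, 4, 2} : Multiset ℕ) = {2, 4, 6} from by decide]
        exact pos_of_frame_of_forall (by norm_num) (by norm_num) (L := 6) (by decide) (by decide)
          (hsmall (3, 5, {2, 4, 6}) (by decide))
      · rw [show ({6, 4, 4} : Multiset ℕ) = {4, 4, 6} from by decide]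
        exact pos_of_frame_of_forall (by norm_num) (by norm_num) (L := 6) (by decide) (by decide)
          (hsmall (3, 6, {4, 4, 6}) (by decide))
      · rw [show ({6, 4, 6} : Multiset ℕ) = {4, 6, 6} from by decide]
        exact pos_of_frame_of_forall (by norm_num) (by norm_num) (L := 6) (by decide) (by decide)
          (hsmall (4, 5, {4, 6, 6}) (by decide))
      · rw [show ({6, 6, 1} : Multiset ℕ) = {1, 6, 6} from by decide]
        exact pos_of_frame_of_forall (by norm_num) (by norm_num) (L := 6) (by decide) (by decide)
          (hsmall (3, 6, {1, 6, 6}) (by decide))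
      · rw [show ({6, 6, 2} : Multiset ℕ) = {2, 6, 6} from by decide]
        exact pos_of_frame_of_forall (by norm_num) (by norm_num) (L := 6) (by decide) (by decide)
          (hsmall (3, 6, {2, 6, 6}) (by decide))
      · rw [show ({6, 6, 4} : Multiset ℕ) = {4, 6, 6} from by decide]
        exact pos_of_frame_of_forall (by norm_num) (by norm_num) (L := 6) (by decide) (by decide)
          (hsmall (4, 5, {4, 6, 6}) (by decide))
      · exact pos_of_frame_of_forall (by norm_num) (by norm_num) (L := 6) (by decide) (by decide)
          (hsmall (4, 6, {6, 6, 6}) (by decide))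
  · -- the six further groups
    intro A hAmem
    simp only [List.mem_cons, List.mem_nil_iff, or_false] at hAmem
    rcases hAmem with rfl | rfl | rfl | rfl | rfl | rfl
    · exact pos_of_frame_of_forall (by norm_num) (by norm_num) (L := 6) (by decide) (by decide)
        (hsmall (3, 3, {1, 1, 1, 2}) (by decide))
    · exact pos_of_frame_of_forall (by norm_num) (by norm_num) (L := 6) (by decide) (by decide)
        (hsmall (3, 5, {1, 2, 2, 2}) (by decide))
    · exact pos_of_frame_of_forall (by norm_num) (by norm_num) (L := 6) (by decide) (by decide)
        (hsmall (4, 4, {1, 1, 1, 1, 2}) (by decide))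
    · exact pos_of_frame_of_forall (by norm_num) (by norm_num) (L := 6) (by decide) (by decide)
        (hsmall (3, 4, {3, 4}) (by decide))
    · exact pos_of_frame_of_forall (by norm_num) (by norm_num) (L := 6) (by decide) (by decide)
        (hsmall (3, 4, {3, 6}) (by decide))
    · exact pos_of_frame_of_forall (by norm_num) (by norm_num) (L := 6) (by decide) (by decide)
        (hsmall (3, 5, {5, 6}) (by decide))
  · intro j hj1 hj46 hj2 hj45
    exact ikenmeyerPanova2017_cor_4_5_fam1_of_five hfam1 (by norm_num) hj1 (by omega) hj2 (by omega)
  · intro j hj2 hj45 hj44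
    exact ikenmeyerPanova2017_cor_4_5_fam11_of_five hfam11 (by norm_num) hj2 (by omega) (by omega)
  · intro j hj4 hj43
    exact ikenmeyerPanova2017_cor_4_5_fam1111_of_five hfam1111 (by norm_num) hj4 (by omega)
  · intro j hj6 hj41
    exact ikenmeyerPanova2017_cor_4_5_fam111111_of_five hfam111111 (by norm_num) hj6 (by omega)
  · intro j hj2 hj43
    exact ikenmeyerPanova2017_cor_4_5_fam21_of_five hfam21 (by norm_num) hj2 (by omega)

end Literature.Computability.Complexity
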